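import Mathlib
import HarnessLib
import Literature.Analysis.FluidPDE.TypeIAncientMild
import Literature.Analysis.FluidPDE.NewtonKernel
import Literature.Analysis.FluidPDE.NSBoundedMildSmoothing
import Summits.NavierStokesRegularity.NavierStokesRegularity.Theorems.QuarterLogPincerQuietCollarDefs

/-!
# Route `QuarterLogPincer`, crux `TypeIQuantSubcubicExp` (stmt-NavierStokesRegularity-24077), line `quiet_collar` — towards QP2
# `stub_cutPair`: THE CUT REFERENCE `V = χ·v(·−1)` — bookkeeping and the MILD DEFECT AS TWO COMMUTATORS

QP2 `CutPair` of ns-idea-7's line `quiet_collar` (v1.1 objects, `Theorems/QuarterLogPincerQuietCollarDefs.lean`) builds, from a Type-I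
ancient mild field `v` and a radial cut-off `χ = radialCutoff r R` (`= 1` on `B̄(r)`, `= 0` off `B(R)`), the REFERENCE `V(t,x) = χ(x)·v(t−1,x)`
on the slab `[0,1−ε]`.  This file is the r-INDEPENDENT bookkeeping QP2 needs in any variant (DIRECTOR-NS KEY-NS #178; the r-uniformity of
the sup clauses of `CutPair` is under discussion with the author, pub-ns-dss bus 2026-08-29T00:42Z):

* `continuousOn_cutRef`, `norm_cutRef_le`, `cutRef_eq_zero_of_le`, `cutRef_eq_of_le`, `eLpNorm_cutRef_le` — the five structural clauses of
  `CutPair` for `V` (continuity on the slab, domination by `|v(·−1)|`, vanishing beyond `R`, `= v(·−1)` on `B̄(r)`, `L³` bound by the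
  `B(R)`-localised slice);
* `mild_eq_shift` — the Oseen identity of the shifted field `τ ↦ v(τ−1)` from base time `0` (`oseenDuhamel_translate`);
* `mildDefect_cutRef_eq` — THE DEFECT OF THE CUT REFERENCE IS A SUM OF TWO COMMUTATORS:
  `mildDefect V t x = (χ(x)·e^{tΔ}v(−1)(x) − e^{tΔ}(χv(−1))(x)) − (χ(x)·B₀(ṽ,ṽ)(t)(x) − B₀(V,V)(t)(x))`, `ṽ = v(·−1)` — the starting point
  of the two commutator estimates (heat commutator `[χ, e^{tΔ}]`, Oseen commutator) that make the defect small.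

HONEST FRAME: bookkeeping about a hypothetical Type-I field and a cut-off; nothing here bears on 24077, W7 or Navier–Stokes regularity (OPEN).
Helper of the pub-ns-dss typer (g36), `--supports 24077`.
-/

noncomputable section

set_option linter.dupNamespace false

namespace Summit.NavierStokesRegularity.NavierStokesRegularity.Cruxes.TypeIQuantSubcubicExp.QuietCollar

open MeasureTheory Set Function Filter Real Metric
open scoped ENNReal NNReal Topology
open Literature.Analysis Literature.Analysis.FluidPDE

variable {M : ℝ} {v : ℝ → EuclideanSpace ℝ (Fin 3) → EuclideanSpace ℝ (Fin 3)} {r R ε : ℝ}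

/-! ### The cut reference `V t x = χ x • v (t − 1) x`, `χ = radialCutoff r R` -/

/-- Continuity of the cut reference on the slab `[0, 1−ε] × ℝ³` (`ε > 0`). [folklore] -/
theorem continuousOn_cutRef (hv : IsTypeIAncientMild M v) (hε : 0 < ε) (r R : ℝ) :
    ContinuousOn (uncurry fun t x => radialCutoff r R x • v (t - 1) x) (Set.Icc 0 (1 - ε) ×ˢ Set.univ) := by
  have hχ : Continuous (radialCutoff r R : EuclideanSpace ℝ (Fin 3) → ℝ) := (radialCutoff_contDiff r R (n := 0)).continuous
  have h1 : ContinuousOn (fun p : ℝ × EuclideanSpace ℝ (Fin 3) => uncurry v (p.1 - 1, p.2)) (Set.Icc 0 (1 - ε) ×ˢ Set.univ) := by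
    refine hv.continuousOn_uncurry.comp ((continuous_fst.sub continuous_const).prodMk continuous_snd).continuousOn ?_
    intro p hp
    exact ⟨by simp only [mem_Iio]; linarith [(mem_prod.1 hp).1.2], mem_univ _⟩
  exact ((hχ.comp continuous_snd).continuousOn).smul h1

/-- Domination `‖V t x‖ ≤ ‖v (t−1) x‖`. [folklore] -/
theorem norm_cutRef_le (r R t : ℝ) (x : EuclideanSpace ℝ (Fin 3)) :
    ‖radialCutoff r R x • v (t - 1) x‖ ≤ ‖v (t - 1) x‖ := by
  rw [norm_smul, Real.norm_eq_abs, abs_of_nonneg (radialCutoff_nonneg _ _ _)]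
  exact mul_le_of_le_one_left (norm_nonneg _) (radialCutoff_le_one _ _ _)

/-- The cut reference vanishes beyond `R` (`0 ≤ r < R`). [folklore] -/
theorem cutRef_eq_zero_of_le (hr : 0 ≤ r) (hrR : r < R) (t : ℝ) {x : EuclideanSpace ℝ (Fin 3)} (hx : R ≤ ‖x‖) :
    radialCutoff r R x • v (t - 1) x = 0 := by
  rw [radialCutoff_eq_zero hr hrR hx, zero_smul]

/-- The cut reference is `v(·−1)` on the closed ball `B̄(r)`. [folklore] -/
theorem cutRef_eq_of_le (hr : 0 ≤ r) (hrR : r < R) (t : ℝ) {x : EuclideanSpace ℝ (Fin 3)} (hx : ‖x‖ ≤ r) :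
    radialCutoff r R x • v (t - 1) x = v (t - 1) x := by
  rw [radialCutoff_eq_one hr hrR hx, one_smul]

/-- `‖V t‖₃ ≤ ‖1_{B(0,R)} v(t−1)‖₃`. [folklore] -/
theorem eLpNorm_cutRef_le (hr : 0 ≤ r) (hrR : r < R) (t : ℝ) :
    eLpNorm (fun x => radialCutoff r R x • v (t - 1) x) 3 volume ≤
      eLpNorm ((Metric.ball (0 : EuclideanSpace ℝ (Fin 3)) R).indicator (v (t - 1))) 3 volume := by
  refine eLpNorm_mono fun x => ?_
  by_cases hx : x ∈ Metric.ball (0 : EuclideanSpace ℝ (Fin 3)) R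
  · rw [Set.indicator_of_mem hx]; exact norm_cutRef_le r R t x
  · rw [Set.indicator_of_notMem hx, norm_zero]
    rw [Metric.mem_ball, dist_zero_right, not_lt] at hx
    rw [cutRef_eq_zero_of_le hr hrR t hx, norm_zero]

/-! ### The shifted field is Oseen-mild from base time `0` -/

/-- **Oseen identity of the shifted field `τ ↦ v(τ−1)` from base time `0`**, for `0 < t < 1`. [folklore] -/
theorem mild_eq_shift (hv : IsTypeIAncientMild M v) {t : ℝ} (ht0 : 0 < t) (ht1 : t < 1) (x : EuclideanSpace ℝ (Fin 3)) :
    v (t - 1) x = heatFlow (v (0 - 1)) t x - oseenDuhamel 1 0 (fun τ => v (τ - 1)) (fun τ => v (τ - 1)) t x := by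
  have h := hv.mild_eq (s := -1) (t := t - 1) (by linarith) (by linarith) x
  rw [show t - 1 - -1 = t by ring] at h
  have hs : oseenDuhamel 1 0 (fun τ => v (τ - 1)) (fun τ => v (τ - 1)) t x = oseenDuhamel 1 (-1) v v (t - 1) x := by
    have := oseenDuhamel_translate 1 0 (-1) v v t x
    simp only [← sub_eq_add_neg] at this
    rwa [zero_sub] at this
  rw [zero_sub, hs]
  exact h

/-! ### The mild defect of the cut reference = heat commutator − Oseen commutator -/

/-- **THE MILD DEFECT OF THE CUT REFERENCE AS TWO COMMUTATORS**: with `V t x = χ x • v (t−1) x` and `ṽ τ = v (τ−1)`, for `0 < t < 1`,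
`mildDefect V t x = (χ x • e^{tΔ}(v(−1))(x) − e^{tΔ}(χ • v(−1))(x)) − (χ x • B₀(ṽ,ṽ)(t)(x) − B₀(V,V)(t)(x))`. [folklore] -/
theorem mildDefect_cutRef_eq (hv : IsTypeIAncientMild M v) (r R : ℝ) {t : ℝ} (ht0 : 0 < t) (ht1 : t < 1)
    (x : EuclideanSpace ℝ (Fin 3)) :
    mildDefect (fun t x => radialCutoff r R x • v (t - 1) x) t x =
      (radialCutoff r R x • heatFlow (v (0 - 1)) t x - heatFlow (fun y => radialCutoff r R y • v (0 - 1) y) t x) -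
        (radialCutoff r R x • oseenDuhamel 1 0 (fun τ => v (τ - 1)) (fun τ => v (τ - 1)) t x -
          oseenDuhamel 1 0 (fun t x => radialCutoff r R x • v (t - 1) x) (fun t x => radialCutoff r R x • v (t - 1) x) t x) := by
  have hdef : mildDefect (fun t x => radialCutoff r R x • v (t - 1) x) t x =
      radialCutoff r R x • v (t - 1) x - heatFlow (fun y => radialCutoff r R y • v (0 - 1) y) t x +
        oseenDuhamel 1 0 (fun t x => radialCutoff r R x • v (t - 1) x) (fun t x => radialCutoff r R x • v (t - 1) x) t x := rfl
  rw [hdef, mild_eq_shift hv ht0 ht1 x, smul_sub]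
  abel

end Summit.NavierStokesRegularity.NavierStokesRegularity.Cruxes.TypeIQuantSubcubicExp.QuietCollar

end
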